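import Mathlib
import Literature.Computability.AlgebraicComplexity.ReadKDeterminantalRepresentations

/-!
# Read-`k` determinantal representations: the normal form and the counting step

Topic `Computability/AlgebraicComplexity`. This file is the first of the proof files behind
`Literature.Computability.AlgebraicComplexity.HrubesJoglekar2025_variableSize_perPoly`
(Hrubeš–Joglekar 2025, Thm. 7: every determinantal representation of `perm_n` has variable size
`Ω(n^{5/2} / log n)` in characteristic `≠ 2`). It formalises the two "determinant side" steps of
the printed proof (§2 of the paper), in a form that is slightly stronger and easier to formalise
than the printed one:

* **Normal form (printed Lemma 1).** Print reduces an arbitrary determinantal representation of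
  variable size `s` to a `2s × 2s` matrix with the variables on the diagonal, by bordering and
  Gaussian elimination. We use instead the *Weinstein–Aronszajn identity*
  `det (1 + A B) = det (1 + B A)` (Mathlib `Matrix.det_one_add_mul_comm`): if the symbolic matrix
  is `M = C' + U · diag (X_{e v} - c_v) · W` with `C'` an invertible scalar matrix (`U`, `W` the
  `0/1` incidence matrices of the rows/columns of the `s` variable cells `v`, `e v` the variable
  in the cell `v`, `c` a shift of the constants), then
  `det M = det C' · det (1_s + (W C'⁻¹ U) · diag (X_{e v} - c_v))` (`exists_waParam`). Over an
  INFINITE field a shift `c` making `C'` invertible exists as soon as `det M ≠ 0`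
  (`exists_shift`, by `MvPolynomial.funext`). Hence the coefficient vector of `det M` is the value
  of a FIXED polynomial map in `s² + s + 1` parameters (`waGeneric`, `WAParam`), which only
  depends on the labelling `e : V → σ` of the variable cells — fewer parameters than the printed
  `(2s)² + 2sn`.
* **Counting (printed Theorem 2).** Print: a polynomial map `F^K → F^{2^n}` whose image is
  everything forces `K ≥ 2^n` (finite fields by counting, infinite fields by algebraic dependence
  + Schwartz–Zippel). We prove the infinite-field case in the general form
  `card_le_of_forall_exists_eval`: if `x : ι → F[P]` and every `a : ι → F` is `(eval θ (x i))_i`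
  for some `θ`, then `|ι| ≤ |P|` — the family `x` is algebraically independent (a relation would
  vanish on `F^ι`, `MvPolynomial.funext`), and Mathlib's transcendence degree
  (`AlgebraicIndependent.lift_cardinalMk_le_trdeg`, `MvPolynomial.trdeg_of_isDomain`) bounds its
  size. (The finite-field case of print is not needed: the main proof extends scalars to the
  algebraic closure first.) Combined: `two_pow_card_le_of_forall_isShape` — if every multilinear
  polynomial in the variables `σ` is `det` of a symbolic matrix whose variable cells are labelled
  by a fixed `e : V → σ`, then `2^{|σ|} ≤ |V|² + |V| + 1`.

## Main statements

* `IsShape Mg cell e`: the variable cells of the symbolic matrix `Mg` are exactly `cell v`,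
  carrying the variable `e v`.
* `exists_waParam`: `det (symbPoly Mg) = (waGeneric F e)(θ)` for some parameter value `θ`.
* `card_le_of_forall_exists_eval`, `two_pow_card_le_of_forall_isShape`.
* `multilin a`, `coeff_multilin`: the multilinear polynomial with coefficient vector
  `a : (σ → Bool) → F` (monomials indexed by their supports `σ → Bool`, `boolMonomial`).

## References

* P. Hrubeš, P. S. Joglekar, *On read-k projections of the determinant*, STACS 2025,
  LIPIcs 327, 53:1–53:7, Lemma 1 and Theorem 2 (§2, pp. 3–4).
-/

open MvPolynomial Matrix

namespace Literature.Computability.AlgebraicComplexity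

universe u v w

/-! ### The Weinstein–Aronszajn normal form of a symbolic determinantal representation -/

section WA

variable {F : Type u} [Field F] {σ : Type v} {m : ℕ} {V : Type w} [Fintype V]

/-- The parameters of the Weinstein–Aronszajn normal form of a determinantal representation with
variable cells `V`: an `V × V` scalar matrix `B`, a shift `c : V → F`, and one scalar `d`
(`|V|² + |V| + 1` parameters; Hrubeš–Joglekar 2025, proof of Thm. 2, count the `(2s)² + 2sn`
parameters of the printed normal form of Lemma 1 instead). [cite: HrubesJoglekar2025, Lemma 1 and Thm. 2 (pp. 3–4)] -/
abbrev WAParam (V : Type w) : Type w := (V × V) ⊕ (V ⊕ Unit)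

/-- The generic normal form `d · det (1_V + B · diag (X_{e v} - c_v)_v)` of a determinantal
representation whose variable cells `v ∈ V` carry the variables `X_{e v}`, as a polynomial in the
`X`-variables with coefficients polynomials in the parameters `(B, c, d) : WAParam V`
(our replacement of the normal form of Hrubeš–Joglekar 2025, Lemma 1, via Weinstein–Aronszajn).
[cite: HrubesJoglekar2025, Lemma 1 (p. 3)] -/
noncomputable def waGeneric (F : Type u) [Field F] [DecidableEq V] (e : V → σ) :
    MvPolynomial σ (MvPolynomial (WAParam V) F) :=
  let R := MvPolynomial (WAParam V) F
  C (X (Sum.inr (Sum.inr ())) : R) *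
    det ((1 : Matrix V V (MvPolynomial σ R)) +
      (Matrix.of fun v w : V => C (X (Sum.inl (v, w)) : R)) *
      diagonal (fun v => X (e v) - C (X (Sum.inr (Sum.inl v)) : R)))

/-- The constant part of a symbolic matrix over `X(σ) ∪ F`: variable entries replaced by `0`.
[cite: HrubesJoglekar2025, Lemma 1 (p. 3)] -/
def symbConstPart (Mg : Matrix (Fin m) (Fin m) (σ ⊕ F)) : Matrix (Fin m) (Fin m) F :=
  Matrix.of fun i j => Sum.elim (fun _ => (0 : F)) id (Mg i j)

/-- The matrix supported on the cells `cell v`, `v ∈ V`, with the value `d v` in the cell `cell v`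
(for an injective `cell`; in general the sum over the `v` with `cell v = (i, j)`). [folklore] -/
def varPart {R : Type*} [AddCommMonoid R] (cell : V → Fin m × Fin m) (d : V → R) :
    Matrix (Fin m) (Fin m) R :=
  Matrix.of fun i j => ∑ v, if cell v = (i, j) then d v else 0

/-- `IsShape Mg cell e`: the type `V` parametrises the variable cells of the symbolic matrix `Mg`
injectively by `cell`, and the cell `cell v` carries the variable `e v`; all other entries of `Mg`
are constants. (The data `(V, e)` is what the normal form `waGeneric` depends on.)
[cite: HrubesJoglekar2025, Lemma 1 (p. 3)] -/
structure IsShape (Mg : Matrix (Fin m) (Fin m) (σ ⊕ F)) (cell : V → Fin m × Fin m) (e : V → σ) :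
    Prop where
  /-- distinct parameters are distinct cells -/
  inj : Function.Injective cell
  /-- the entry `(i, j)` is the variable `l` iff it is a parametrised cell with label `l` -/
  iff : ∀ i j l, Mg i j = Sum.inl l ↔ ∃ v, cell v = (i, j) ∧ e v = l

variable {cell : V → Fin m × Fin m}

/-- The value of `varPart` in a parametrised cell. [folklore] -/
theorem varPart_apply_cell {R : Type*} [AddCommMonoid R] (hinj : Function.Injective cell)
    (d : V → R) (v : V) : varPart cell d (cell v).1 (cell v).2 = d v := by
  simp only [varPart, Matrix.of_apply, Prod.mk.eta]
  rw [Finset.sum_eq_single v]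
  · simp
  · intro w _ hw
    rw [if_neg (fun h => hw (hinj h))]
  · intro h; exact absurd (Finset.mem_univ v) h

/-- `varPart` vanishes outside the parametrised cells. [folklore] -/
theorem varPart_apply_of_not {R : Type*} [AddCommMonoid R] (d : V → R) (i j : Fin m)
    (h : ∀ v, cell v ≠ (i, j)) : varPart cell d i j = 0 := by
  simp only [varPart, Matrix.of_apply]
  exact Finset.sum_eq_zero fun v _ => if_neg (h v)

/-- `varPart` commutes with additive maps applied entrywise. [folklore] -/
theorem varPart_map {R S G : Type*} [AddCommMonoid R] [AddCommMonoid S] [FunLike G R S]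
    [AddMonoidHomClass G R S] (f : G) (d : V → R) :
    (varPart cell d).map f = varPart cell (fun v => f (d v)) := by
  ext i j
  simp only [varPart, Matrix.map_apply, Matrix.of_apply, map_sum]
  refine Finset.sum_congr rfl fun v _ => ?_
  split_ifs <;> simp

/-- The row incidence matrix `U` of the cells: `U i v = 1` iff `i` is the row of `cell v`.
[folklore] -/
def rowInc (R : Type*) [Zero R] [One R] (cell : V → Fin m × Fin m) : Matrix (Fin m) V R :=
  Matrix.of fun i v => if i = (cell v).1 then 1 else 0

/-- The column incidence matrix `W` of the cells: `W v j = 1` iff `j` is the column of `cell v`.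
[folklore] -/
def colInc (R : Type*) [Zero R] [One R] (cell : V → Fin m × Fin m) : Matrix V (Fin m) R :=
  Matrix.of fun v j => if j = (cell v).2 then 1 else 0

/-- The rank-`|V|` factorisation `varPart d = U · diag d · W`. [folklore] -/
theorem varPart_eq_mul {R : Type*} [CommSemiring R] [DecidableEq V] (d : V → R) :
    varPart cell d = rowInc R cell * diagonal d * colInc R cell := by
  ext i j
  have key : ∀ v, (rowInc R cell * diagonal d) i v = if i = (cell v).1 then d v else 0 := by
    intro v
    rw [Matrix.mul_apply, Finset.sum_eq_single v]
    · simp only [rowInc, Matrix.of_apply, diagonal_apply_eq]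
      split_ifs <;> simp
    · intro w _ hw
      rw [diagonal_apply_ne _ hw, mul_zero]
    · intro h; exact absurd (Finset.mem_univ v) h
  rw [Matrix.mul_apply]
  simp only [key, varPart, Matrix.of_apply, colInc]
  refine Finset.sum_congr rfl fun v _ => ?_
  by_cases h : cell v = (i, j)
  · have h1 : i = (cell v).1 := by rw [h]
    have h2 : j = (cell v).2 := by rw [h]
    rw [if_pos h, if_pos h1, if_pos h2, mul_one]
  · rw [if_neg h]
    by_cases h1 : i = (cell v).1
    · have h2 : ¬ j = (cell v).2 := fun h2 => h (Prod.ext h1.symm h2.symm)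
      rw [if_neg h2, mul_zero]
    · rw [if_neg h1, zero_mul]

omit [Fintype V] in
/-- `U` is a `0/1` matrix: it is preserved by maps fixing `0` and `1`. [folklore] -/
theorem rowInc_map {R S : Type*} [Zero R] [One R] [Zero S] [One S] (f : R → S) (h0 : f 0 = 0)
    (h1 : f 1 = 1) : (rowInc R cell).map f = rowInc S cell := by
  ext i v
  simp only [rowInc, Matrix.map_apply, Matrix.of_apply]
  split_ifs <;> simp [h0, h1]

omit [Fintype V] in
/-- `W` is a `0/1` matrix: it is preserved by maps fixing `0` and `1`. [folklore] -/
theorem colInc_map {R S : Type*} [Zero R] [One R] [Zero S] [One S] (f : R → S) (h0 : f 0 = 0)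
    (h1 : f 1 = 1) : (colInc R cell).map f = colInc S cell := by
  ext i v
  simp only [colInc, Matrix.map_apply, Matrix.of_apply]
  split_ifs <;> simp [h0, h1]

variable {Mg : Matrix (Fin m) (Fin m) (σ ⊕ F)} {e : V → σ}

/-- The matrix of polynomials of a symbolic matrix of shape `(cell, e)`, with an arbitrary shift
`c` of the constants in the variable cells:
`symbPoly Mg = (C₀ + Σ_v c_v E_{cell v}) + Σ_v (X_{e v} - c_v) E_{cell v}`.
[cite: HrubesJoglekar2025, Lemma 1 (p. 3)] -/
theorem symbPoly_eq_of_isShape (h : IsShape Mg cell e) (c : V → F) :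
    symbPoly Mg = (symbConstPart Mg + varPart cell c).map C +
      varPart cell (fun v => X (e v) - C (c v)) := by
  ext i j
  simp only [symbPoly, Matrix.map_apply, Matrix.add_apply, symbConstPart, Matrix.of_apply]
  by_cases hv : ∃ v, cell v = (i, j)
  · obtain ⟨v, hv⟩ := hv
    have hij : Mg i j = Sum.inl (e v) := (h.iff i j (e v)).2 ⟨v, hv, rfl⟩
    have h1 : i = (cell v).1 := by rw [hv]
    have h2 : j = (cell v).2 := by rw [hv]
    rw [hij]
    subst h1 h2
    rw [varPart_apply_cell h.inj, varPart_apply_cell h.inj]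
    simp
  · push Not at hv
    rw [varPart_apply_of_not _ _ _ hv, varPart_apply_of_not _ _ _ hv]
    rcases hij : Mg i j with l | a
    · exact absurd ((h.iff i j l).1 hij) (fun ⟨v, hv', _⟩ => hv v hv')
    · simp

/-- The polynomial `D(t) = det (C₀ + Σ_v t_v E_{cell v})` in indeterminates `t_v`, `v ∈ V`, whose
non-vanishing at `c` makes the shifted constant matrix invertible. [cite: HrubesJoglekar2025, Lemma 1 (p. 3)] -/
noncomputable def shiftDet (Mg : Matrix (Fin m) (Fin m) (σ ⊕ F)) (cell : V → Fin m × Fin m) :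
    MvPolynomial V F :=
  det ((symbConstPart Mg).map C + varPart cell (fun v => (X v : MvPolynomial V F)))

/-- `D(c) = det (C₀ + Σ_v c_v E_{cell v})`. [cite: HrubesJoglekar2025, Lemma 1 (p. 3)] -/
theorem eval_shiftDet (c : V → F) :
    eval c (shiftDet Mg cell) = det (symbConstPart Mg + varPart cell c) := by
  unfold shiftDet
  rw [RingHom.map_det, RingHom.mapMatrix_apply, Matrix.map_add _ (map_add _), Matrix.map_map,
    varPart_map]
  congr 2
  · ext i j; simp
  · simp

/-- Substituting `t_v ↦ X_{e v}` in `D` gives back `det (symbPoly Mg)`. [cite: HrubesJoglekar2025, Lemma 1 (p. 3)] -/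
theorem aeval_shiftDet (h : IsShape Mg cell e) :
    aeval (fun v => (X (e v) : MvPolynomial σ F)) (shiftDet Mg cell) = (symbPoly Mg).det := by
  unfold shiftDet
  rw [← AlgHom.coe_toRingHom, RingHom.map_det, RingHom.mapMatrix_apply, symbPoly_eq_of_isShape h 0,
    Matrix.map_add _ (map_add _), Matrix.map_map, varPart_map]
  congr 2
  · ext i j
    simp [varPart]
  · simp

/-- **A good shift exists over an infinite field**: if `det (symbPoly Mg) ≠ 0` then `D ≠ 0`, so
`D(c) ≠ 0` for some `c` (`MvPolynomial.funext`). This replaces the rank/elimination argument of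
Hrubeš–Joglekar 2025, Lemma 1. [cite: HrubesJoglekar2025, Lemma 1 (p. 3)] -/
theorem exists_shift [Infinite F] (h : IsShape Mg cell e) (hg : (symbPoly Mg).det ≠ 0) :
    ∃ c : V → F, det (symbConstPart Mg + varPart cell c) ≠ 0 := by
  by_contra hc
  push Not at hc
  apply hg
  rw [← aeval_shiftDet h]
  have : shiftDet Mg cell = 0 :=
    MvPolynomial.funext fun c => by rw [eval_shiftDet, hc c, map_zero]
  rw [this, map_zero]

/-- **Weinstein–Aronszajn normal form of a symbolic determinantal representation** (our
replacement of Hrubeš–Joglekar 2025, Lemma 1): over an infinite field, if the symbolic matrix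
`Mg` has shape `(cell, e)` then `det (symbPoly Mg) = d · det (1_V + B · diag (X_{e v} - c_v))`
for some scalars `(B, c, d)`, i.e. it is a specialisation of `waGeneric F e`. Proof: if the
determinant is `0` take `d = 0`; otherwise shift by `exists_shift` so that
`symbPoly Mg = C' (1 + C'⁻¹ U diag W)` with `C'` invertible and apply
`Matrix.det_one_add_mul_comm` with `B = W C'⁻¹ U`, `d = det C'`. [cite: HrubesJoglekar2025, Lemma 1 (p. 3)] -/
theorem exists_waParam [Infinite F] [DecidableEq V] (h : IsShape Mg cell e) :
    ∃ θ : WAParam V → F, (symbPoly Mg).det = MvPolynomial.map (eval θ) (waGeneric F e) := by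
  -- the right-hand side, computed
  have rhs : ∀ (B : Matrix V V F) (c : V → F) (d : F),
      MvPolynomial.map (eval (Sum.elim (fun vw => B vw.1 vw.2) (Sum.elim c fun _ => d)))
        (waGeneric F e) =
      C d * det ((1 : Matrix V V (MvPolynomial σ F)) + B.map C *
        diagonal (fun v => X (e v) - C (c v))) := by
    intro B c d
    simp only [waGeneric]
    rw [map_mul, map_C, RingHom.map_det, RingHom.mapMatrix_apply, Matrix.map_add _ (map_add _),
      Matrix.map_mul, Matrix.map_one _ (map_zero _) (map_one _), diagonal_map (map_zero _)]
    congr 2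
    · simp
    · congr 2
      · ext v w
        simp
      · funext v
        simp
  by_cases hg : (symbPoly Mg).det = 0
  · refine ⟨Sum.elim (fun vw => (0 : Matrix V V F) vw.1 vw.2) (Sum.elim (fun _ => 0) fun _ => 0), ?_⟩
    rw [rhs, hg, C_0, zero_mul]
  obtain ⟨c, hc⟩ := exists_shift h hg
  set C' := symbConstPart Mg + varPart cell c with hC'
  have hunit : IsUnit C'.det := isUnit_iff_ne_zero.2 hc
  set B : Matrix V V F := colInc F cell * C'⁻¹ * rowInc F cell with hB
  refine ⟨Sum.elim (fun vw => B vw.1 vw.2) (Sum.elim c fun _ => C'.det), ?_⟩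
  rw [rhs]
  set dX : V → MvPolynomial σ F := fun v => X (e v) - C (c v) with hdX
  have h1 : symbPoly Mg = (C'.map C : Matrix (Fin m) (Fin m) (MvPolynomial σ F)) *
      (1 + (C'⁻¹.map C : Matrix (Fin m) (Fin m) (MvPolynomial σ F)) * rowInc (MvPolynomial σ F) cell *
        diagonal dX * colInc (MvPolynomial σ F) cell) := by
    rw [Matrix.mul_add, Matrix.mul_one, ← Matrix.mul_assoc, ← Matrix.mul_assoc, ← Matrix.mul_assoc,
      ← Matrix.map_mul, mul_nonsing_inv _ hunit, Matrix.map_one _ C_0 C_1, Matrix.one_mul,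
      symbPoly_eq_of_isShape h c, varPart_eq_mul dX]
  have h2 : (B.map C : Matrix V V (MvPolynomial σ F)) =
      colInc (MvPolynomial σ F) cell * (C'⁻¹.map C : Matrix (Fin m) (Fin m) (MvPolynomial σ F)) *
        rowInc (MvPolynomial σ F) cell := by
    rw [hB, Matrix.map_mul, Matrix.map_mul, colInc_map _ C_0 C_1, rowInc_map _ C_0 C_1]
  rw [h1, det_mul, det_one_add_mul_comm, ← Matrix.mul_assoc, ← Matrix.mul_assoc, ← h2,
    ← RingHom.mapMatrix_apply, ← RingHom.map_det]

end WA

/-! ### The counting step -/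

section Counting

open Cardinal

/-- **A polynomial map `F^P → F^ι` over an infinite field whose image is all of `F^ι` has
`|ι| ≤ |P|`** (the infinite-field case of Hrubeš–Joglekar 2025, proof of Thm. 2: the components
are algebraically independent — a relation would be a nonzero polynomial vanishing on `F^ι` —
and at most `trdeg F[P] = |P|` polynomials of `F[P]` are algebraically independent).
[cite: HrubesJoglekar2025, Thm. 2 (p. 4)] -/
theorem card_le_of_forall_exists_eval {F : Type u} [Field F] [Infinite F] {ι : Type v} {P : Type w}
    [Fintype ι] [Fintype P] (x : ι → MvPolynomial P F)
    (h : ∀ a : ι → F, ∃ θ : P → F, ∀ i, a i = eval θ (x i)) :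
    Fintype.card ι ≤ Fintype.card P := by
  classical
  have hx : AlgebraicIndependent F x := by
    rw [AlgebraicIndependent]
    intro H₁ H₂ hH
    rw [← sub_eq_zero] at hH ⊢
    rw [← map_sub] at hH
    apply MvPolynomial.funext
    intro a
    obtain ⟨θ, hθ⟩ := h a
    rw [map_zero]
    have : eval a (H₁ - H₂) = eval θ (aeval x (H₁ - H₂)) := by
      rw [show a = fun i => eval θ (x i) from funext hθ, MvPolynomial.aeval_eq_bind₁]
      exact (eval₂Hom_bind₁ _ _ _ _).symm
    rw [this, hH, map_zero]
  have h1 := hx.lift_cardinalMk_le_trdeg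
  rw [MvPolynomial.trdeg_of_isDomain] at h1
  simp only [Cardinal.mk_fintype, Cardinal.lift_natCast] at h1
  exact_mod_cast h1

variable {F : Type u} [Field F] {σ : Type v}

/-- The exponent vector of the multilinear monomial `∏_{i : b i} X_i` with support `b : σ → Bool`.
[folklore] -/
noncomputable def boolMonomial [Finite σ] (b : σ → Bool) : σ →₀ ℕ :=
  Finsupp.equivFunOnFinite.symm fun i => if b i then 1 else 0

omit [Field F] in
/-- The exponents of `boolMonomial b` are `0/1` according to `b`. [folklore] -/
theorem boolMonomial_apply [Finite σ] (b : σ → Bool) (i : σ) :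
    boolMonomial b i = if b i then 1 else 0 := by
  simp [boolMonomial]

omit [Field F] in
/-- Distinct supports give distinct multilinear monomials. [folklore] -/
theorem boolMonomial_injective [Finite σ] : Function.Injective (boolMonomial (σ := σ)) := by
  intro b b' h
  funext i
  have := congrArg (fun f => f i) h
  simp only [boolMonomial_apply] at this
  cases hb : b i <;> cases hb' : b' i <;> simp_all

/-- The multilinear polynomial `∑_b a_b ∏_{i : b i} X_i` with coefficient vector
`a : (σ → Bool) → F` (Hrubeš–Joglekar 2025, §2: "multilinear polynomial `f ∈ 𝔽[x_1, …, x_n]`",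
with its `2^n` coefficients). [cite: HrubesJoglekar2025, Thm. 2 (p. 4)] -/
noncomputable def multilin [Finite σ] (a : (σ → Bool) → F) [Fintype (σ → Bool)] :
    MvPolynomial σ F :=
  ∑ b, monomial (boolMonomial b) (a b)

/-- The coefficients of `multilin a` are the `a_b`. [cite: HrubesJoglekar2025, Thm. 2 (p. 4)] -/
theorem coeff_multilin [Finite σ] [Fintype (σ → Bool)] (a : (σ → Bool) → F) (b : σ → Bool) :
    coeff (boolMonomial b) (multilin a) = a b := by
  classical
  unfold multilin
  rw [coeff_sum, Finset.sum_eq_single b]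
  · rw [coeff_monomial, if_pos rfl]
  · intro b' _ hb'
    rw [coeff_monomial, if_neg (fun h => hb' (boolMonomial_injective h))]
  · intro h; exact absurd (Finset.mem_univ b) h

/-- **Counting** (the use of Hrubeš–Joglekar 2025, Thm. 2 inside the proof of Thm. 7, in our
normal form): over an infinite field, if EVERY multilinear polynomial in the variables `σ` is the
determinant of a symbolic matrix whose variable cells are labelled by one fixed `e : V → σ`
(sizes, cells and constants may vary), then `2^{|σ|} ≤ |V|² + |V| + 1`: by `exists_waParam` all
`2^{|σ|}` coefficients are values of the fixed polynomials `coeff_b (waGeneric F e)` in the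
`|V|² + |V| + 1` parameters, and `card_le_of_forall_exists_eval` applies.
[cite: HrubesJoglekar2025, Thm. 2 (p. 4) and proof of Thm. 7 (p. 6)] -/
theorem two_pow_card_le_of_forall_isShape [Infinite F] [Fintype σ] [DecidableEq σ] {V : Type w}
    [Fintype V] [DecidableEq V] (e : V → σ)
    (h : ∀ a : (σ → Bool) → F, ∃ (m : ℕ) (Mg : Matrix (Fin m) (Fin m) (σ ⊕ F))
      (cell : V → Fin m × Fin m), IsShape Mg cell e ∧ (symbPoly Mg).det = multilin a) :
    2 ^ Fintype.card σ ≤ Fintype.card V ^ 2 + Fintype.card V + 1 := by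
  have key := card_le_of_forall_exists_eval (F := F) (ι := σ → Bool) (P := WAParam V)
    (fun b => coeff (boolMonomial b) (waGeneric F e)) (fun a => by
      obtain ⟨m, Mg, cell, hshape, hdet⟩ := h a
      obtain ⟨θ, hθ⟩ := exists_waParam hshape
      refine ⟨θ, fun b => ?_⟩
      rw [← coeff_multilin a b, ← hdet, hθ, coeff_map])
  simp only [Fintype.card_fun, Fintype.card_bool, Fintype.card_sum, Fintype.card_prod,
    Fintype.card_unit] at key
  rw [pow_two]
  omega

end Counting

end Literature.Computability.AlgebraicComplexity
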